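import Summits.BirchSwinnertonDyer.BirchSwinnertonDyer.Theorems.TeichmullerTwistDescentLocalPTorsionLine
import Mathlib.RingTheory.Polynomial.Eisenstein.IsIntegral
import HarnessLib

/-!
# No `ζ_p` in an UNRAMIFIED `p`-adic field (`p` odd), hence `E(K)[p]` is cyclic for every elliptic curve over
# such a field — the torsion input of the F″ receptacle over unramified `K ⊇ ℚ_p` (crux LOW / F″ programme T57)

Cell `pub/bsd-wall`, D-0145 line `route-BirchSwinnertonDyer-TeichmullerTwistDescent` (rev 5), crux LOW
`SupersingularTorsionOptimalManinUnitFive` (stmt-BirchSwinnertonDyer-23884), seat `bsd-line-ttd-p1` g3; sequel of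
`TeichmullerTwistDescentLocalPTorsionLine` (same namespace). THEOREMS ONLY (no definition, no named fact, no `sorry`);
a `--supports` helper: BSD is not proved here and LOW stays open.

WHY. After tonight's Ihara-free closers (`TeichmullerTwistDescent.not_dvd_c_of_kato`, seat ttd-p2 g3) the WHOLE Manin
side of the route — LOW included — rests on exactly two cite-only printed facts, modularity and Kato's fact F″
`Literature.NumberTheory.EllipticCurves.kato_neron_isIntegral_twistedSymbolSum_of_additive_five_le`, whose `p ∈ {5, 7}`
clause is the Kosters–Pannekoek receptacle over the UNRAMIFIED completions `K = ℚ(ζ_m)_v` (`gcd(ord_m p, p − 1) = 1 ∧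
V(ℚ_p)[p] = 0 ⟹ E₀(K)[p] = 0`). The F″ programme of the Edixhoven seats (map `kato-lever-F2-programme.md`; P2 landed
as `StarredOptimalManinUnitFiveSevenReceptacle.…`, edix-p1 g5) consumes `E₀(K)[p] = 0` over unramified `K`; its planned
descent (edix-p2 g4, T57) needs «`E(K)[p]` has `𝔽_p`-dimension `≤ 1`», which that seat proposed to get WITHOUT the Weil
pairing by a cusp valuation of `ψ_p(0)`. The Weil pairing being PROVED in the tree, the dimension bound is instead the
two-line consequence of «no primitive `p`-th root of unity in `K`» (`LocalPTorsionLine.isAddCyclic_torsionBy_prime_of_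
forall_not_isPrimitiveRoot`, Silverman *AEC* III.8.1.1); this file supplies that input in the programme's own currency
(`NormedAlgebra ℚ_[p] K`, unramified as the VALUE condition `‖x‖ < 1 → ‖x‖ ≤ ‖p‖`).

## What is proved

* §1 (any ultrametric normed field `K` with `0 < ‖p‖ < 1`): **`‖ζ − 1‖^{p−1} = ‖p‖` for a primitive `p`-th root of unity
  `ζ ∈ K`** (`norm_sub_one_pow_eq_of_isPrimitiveRoot`): `u = ζ − 1` is a root of the EISENSTEIN polynomial `Φ_p(X + 1)`
  (Mathlib `cyclotomic_comp_X_add_one_isEisensteinAt`: monic of degree `p − 1`, lower coefficients divisible by `p`,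
  constant term `Φ_p(1) = p`), so `u^{p−1} = −Σ_{i<p−1} a_i u^i` with `‖a_0‖ = ‖p‖` and `‖a_i u^i‖ ≤ ‖p‖‖u‖^i`; first
  `‖u‖ < 1` (else the right side is `< ‖u‖^{p−1}`), then the constant term dominates. Hence (`p` odd, UNRAMIFIED value
  condition) **no primitive `p`-th root of unity** (`not_isPrimitiveRoot_of_unramified`: `‖u‖ ≤ ‖p‖` would give
  `‖p‖ = ‖u‖^{p−1} ≤ ‖p‖^{p−1} < ‖p‖`), and `E(K)[p]` cyclic, `#E(K)[p] ∣ p`, `ℕ`-multiple generator, for every elliptic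
  curve over `K` of characteristic `0` (`…_of_unramified`).
* §2 the same in the `ℚ_p`-algebra currency `[NormedAlgebra ℚ_[p] K]` (`‖(p : K)‖ = ‖p‖_p < 1`, `char K = 0` automatic):
  `not_isPrimitiveRoot_of_unramified_padicAlgebra`, **`isAddCyclic_torsionBy_prime_of_unramified_padicAlgebra`**,
  `natCard_torsionBy_prime_dvd_of_unramified_padicAlgebra`, `exists_generator_of_unramified_padicAlgebra`, and the
  descent shape `exists_nsmul_eq_of_unramified_padicAlgebra` (a non-zero `P` of order `p` spans all of `E(K)[p]`: two
  `𝔽_p`-independent `K`-rational `p`-torsion points do not exist over an unramified `K`, `p` odd).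

Serre, *Corps locaux* IV §4 Prop. 17 / *Cours d'arithmétique* II §3.1: `ℚ_p(ζ_p)/ℚ_p` is totally ramified of degree
`p − 1` with uniformiser `ζ_p − 1`; the norm identity of §1 is its valuation-theoretic content, proved here for any
ultrametric field. References: [SerreLocalFields1979] IV §4 Prop. 17; [Serre1973] Ch. II §3.1 Prop. 7;
[SilvermanAEC2009] Cor. III.8.1.1; [KostersPannekoek2017] Thm. 1 (the receptacle's exceptional case over unramified `K`);
[KimNakamura2020] Thm. 2.1, Remark 1.8 (1). Design: no definitions; axioms `propext`, `Classical.choice`, `Quot.sound`.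
-/

-- the Theorems directory repeats the summit name (sibling precedent `EdixhovenFibreFiveSevenKPResidueOfCornerLow.lean`)
set_option linter.dupNamespace false

noncomputable section

open scoped Classical NNReal

namespace Summit.BirchSwinnertonDyer.BirchSwinnertonDyer.Theorems.TeichmullerTwistDescent.LocalPTorsionLine

open WeierstrassCurve Polynomial

/-! ## §1 Ultrametric normed fields: `‖ζ_p − 1‖^{p−1} = ‖p‖`; no `ζ_p` under the unramified value condition -/

section Unramified

variable {K : Type*} [NormedField K] [IsUltrametricDist K] (p : ℕ) [hp : Fact p.Prime]

/-- **`‖ζ − 1‖^{p−1} = ‖p‖` for a primitive `p`-th root of unity `ζ` in an ultrametric normed field with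
`0 < ‖p‖ < 1`** (the valuation of the uniformiser `ζ_p − 1` of `ℚ_p(ζ_p)`, here for any such field): `ζ − 1` is a root
of the Eisenstein polynomial `Φ_p(X + 1)` (Mathlib `cyclotomic_comp_X_add_one_isEisensteinAt`), whose constant term
`Φ_p(1) = p` dominates the other lower terms once `‖ζ − 1‖ < 1`, which the same identity forces.
[cite: SerreLocalFields1979, IV §4 Prop 17] -/
theorem norm_sub_one_pow_eq_of_isPrimitiveRoot (hp0 : (p : K) ≠ 0) (hpK : ‖(p : K)‖ < 1) {ζ : K}
    (hζ : IsPrimitiveRoot ζ p) : ‖ζ - 1‖ ^ (p - 1) = ‖(p : K)‖ := by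
  -- the Eisenstein polynomial `f = Φ_p(X + 1)`
  set f : ℤ[X] := (cyclotomic p ℤ).comp (X + 1) with hf
  have hE : f.IsEisensteinAt (Submodule.span ℤ {(p : ℤ)}) := cyclotomic_comp_X_add_one_isEisensteinAt p
  have hmonic : f.Monic := by
    rw [hf, show (X + 1 : ℤ[X]) = X + C 1 by simp]
    refine (cyclotomic.monic p ℤ).comp (monic_X_add_C 1) fun h => ?_
    rw [natDegree_X_add_C] at h
    exact zero_ne_one h.symm
  have hdeg : f.natDegree = p - 1 := by
    rw [hf, natDegree_comp, natDegree_cyclotomic, Nat.totient_prime hp.out,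
      show (X + 1 : ℤ[X]) = X + C 1 by simp, natDegree_X_add_C, mul_one]
  have hcoeff0 : f.coeff 0 = p := by
    rw [coeff_zero_eq_eval_zero, hf, eval_comp, eval_add, eval_X, eval_one, zero_add,
      eval_one_cyclotomic_prime]
  have hcoeff_dvd : ∀ i, i < p - 1 → (p : ℤ) ∣ f.coeff i := by
    intro i hi
    have := hE.mem (by rw [hdeg]; exact hi)
    rwa [Ideal.mem_span_singleton] at this
  have hcoeff_top : f.coeff (p - 1) = 1 := by
    rw [← hdeg]; exact hmonic
  -- `u = ζ - 1` is a root of `f`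
  set u : K := ζ - 1 with hu
  have hroot : (f.map (Int.castRingHom K)).eval u = 0 := by
    rw [hf, map_comp, eval_comp, Polynomial.map_add, map_X, Polynomial.map_one, eval_add, eval_X, eval_one,
      map_cyclotomic, hu, sub_add_cancel]
    exact (hζ.isRoot_cyclotomic hp.out.pos).eq_zero
  -- expand: `0 = Σ_{i<p-1} a_i u^i + u^(p-1)`
  have hp1 : p - 1 + 1 = p := Nat.sub_add_cancel hp.out.one_lt.le
  have hsum : (f.map (Int.castRingHom K)).eval u =
      (∑ i ∈ Finset.range (p - 1), ((f.coeff i : ℤ) : K) * u ^ i) + u ^ (p - 1) := by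
    rw [eval_eq_sum_range' (n := p) (by rw [natDegree_map_of_leadingCoeff_ne_zero _ (by
        rw [hmonic.leadingCoeff, map_one]; exact one_ne_zero), hdeg]; omega)]
    conv_lhs => rw [← hp1]
    rw [Finset.sum_range_succ]
    congr 1
    · refine Finset.sum_congr rfl fun i _ => ?_
      rw [coeff_map, eq_intCast]
    · rw [coeff_map, hcoeff_top, map_one, one_mul]
  rw [hsum] at hroot
  have hupow : u ^ (p - 1) = -∑ i ∈ Finset.range (p - 1), ((f.coeff i : ℤ) : K) * u ^ i :=
    eq_neg_of_add_eq_zero_right hroot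
  -- norms of the lower terms
  have hnp : 0 < ‖(p : K)‖ := norm_pos_iff.mpr hp0
  have hterm : ∀ i ∈ Finset.range (p - 1), ‖((f.coeff i : ℤ) : K) * u ^ i‖ ≤ ‖(p : K)‖ * ‖u‖ ^ i := by
    intro i hi
    rw [Finset.mem_range] at hi
    obtain ⟨b, hb⟩ := hcoeff_dvd i hi
    rw [norm_mul, norm_pow, hb, Int.cast_mul, Int.cast_natCast, norm_mul]
    gcongr
    exact mul_le_of_le_one_right (norm_nonneg _) (IsUltrametricDist.norm_intCast_le_one K b)
  -- Step 1: `‖u‖ < 1`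
  have hu1 : ‖u‖ < 1 := by
    by_contra hge
    rw [not_lt] at hge
    have hC : ∀ i ∈ Finset.range (p - 1), ‖((f.coeff i : ℤ) : K) * u ^ i‖ ≤ ‖(p : K)‖ * ‖u‖ ^ (p - 2) := by
      intro i hi
      refine (hterm i hi).trans ?_
      rw [Finset.mem_range] at hi
      exact mul_le_mul_of_nonneg_left (pow_le_pow_right₀ hge (by omega)) (norm_nonneg _)
    have hle : ‖u‖ ^ (p - 1) ≤ ‖(p : K)‖ * ‖u‖ ^ (p - 2) := by
      rw [← norm_pow, hupow, norm_neg]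
      exact IsUltrametricDist.norm_sum_le_of_forall_le_of_nonneg (by positivity) hC
    have hlt : ‖(p : K)‖ * ‖u‖ ^ (p - 2) < ‖u‖ ^ (p - 1) := by
      calc ‖(p : K)‖ * ‖u‖ ^ (p - 2) < 1 * ‖u‖ ^ (p - 2) := by
            gcongr
          _ = ‖u‖ ^ (p - 2) := one_mul _
          _ ≤ ‖u‖ ^ (p - 1) := pow_le_pow_right₀ hge (by omega)
    exact absurd hle (not_le.mpr hlt)
  -- Step 2: the constant term dominates
  rcases Nat.lt_or_ge 1 (p - 1) with h2 | h2
  · -- `p ≥ 3`: split off the term `i = 0`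
    have hsplit : ∑ i ∈ Finset.range (p - 1), ((f.coeff i : ℤ) : K) * u ^ i =
        (p : K) + ∑ i ∈ Finset.Ico 1 (p - 1), ((f.coeff i : ℤ) : K) * u ^ i := by
      rw [Finset.range_eq_Ico, Finset.sum_eq_sum_Ico_succ_bot (by omega), hcoeff0]
      simp
    have htail : ‖∑ i ∈ Finset.Ico 1 (p - 1), ((f.coeff i : ℤ) : K) * u ^ i‖ < ‖(p : K)‖ := by
      have hC : ∀ i ∈ Finset.Ico 1 (p - 1), ‖((f.coeff i : ℤ) : K) * u ^ i‖ ≤ ‖(p : K)‖ * ‖u‖ := by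
        intro i hi
        rw [Finset.mem_Ico] at hi
        refine (hterm i (Finset.mem_range.mpr hi.2)).trans ?_
        exact mul_le_mul_of_nonneg_left (pow_le_of_le_one (norm_nonneg _) hu1.le (by omega)) (norm_nonneg _)
      refine (IsUltrametricDist.norm_sum_le_of_forall_le_of_nonneg (by positivity) hC).trans_lt ?_
      exact mul_lt_of_lt_one_right hnp hu1
    rw [← norm_pow, hupow, norm_neg, hsplit, IsUltrametricDist.norm_add_eq_max_of_norm_ne_norm (ne_of_gt htail),
      max_eq_left htail.le]
  · -- `p = 2`: the sum is the single term `p`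
    have hp2 : p - 1 = 1 := by have := hp.out.two_le; omega
    rw [hp2] at hupow ⊢
    rw [pow_one] at hupow
    rw [pow_one, hupow, norm_neg, Finset.sum_range_one, pow_zero, mul_one, hcoeff0, Int.cast_natCast]

/-- **No primitive `p`-th root of unity under the UNRAMIFIED value condition** (`p` odd, `0 < ‖p‖ < 1`,
`∀ x, ‖x‖ < 1 → ‖x‖ ≤ ‖p‖`): `‖ζ − 1‖ < 1` would give `‖ζ − 1‖ ≤ ‖p‖`, hence `‖p‖ = ‖ζ − 1‖^{p−1} ≤ ‖p‖^{p−1} < ‖p‖`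
(`p − 1 ≥ 2`). (`ℚ_p(ζ_p)/ℚ_p` is totally ramified of degree `p − 1`.) [cite: SerreLocalFields1979, IV §4 Prop 17]
[cite: Serre1973, Ch. II §3.1 Prop. 7] -/
theorem not_isPrimitiveRoot_of_unramified (hp2 : p ≠ 2) (hp0 : (p : K) ≠ 0) (hpK : ‖(p : K)‖ < 1)
    (hK : ∀ x : K, ‖x‖ < 1 → ‖x‖ ≤ ‖(p : K)‖) (ζ : K) : ¬ IsPrimitiveRoot ζ p := by
  intro hζ
  have e := norm_sub_one_pow_eq_of_isPrimitiveRoot p hp0 hpK hζ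
  have hnp : 0 < ‖(p : K)‖ := norm_pos_iff.mpr hp0
  have h3 : 2 ≤ p - 1 := by
    have := hp.out.two_le
    rcases hp.out.eq_two_or_odd' with h | h
    · exact absurd h hp2
    · obtain ⟨k, hk⟩ := h; omega
  have hu1 : ‖ζ - 1‖ < 1 := by
    by_contra hge
    rw [not_lt] at hge
    have : 1 ≤ ‖ζ - 1‖ ^ (p - 1) := one_le_pow₀ hge
    rw [e] at this
    exact absurd hpK (not_lt.mpr this)
  have hle := hK _ hu1
  have : ‖(p : K)‖ ≤ ‖(p : K)‖ ^ (p - 1) :=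
    calc ‖(p : K)‖ = ‖ζ - 1‖ ^ (p - 1) := e.symm
      _ ≤ ‖(p : K)‖ ^ (p - 1) := pow_le_pow_left₀ (norm_nonneg _) hle _
  have hlt : ‖(p : K)‖ ^ (p - 1) < ‖(p : K)‖ := pow_lt_self_of_lt_one₀ hnp hpK (by omega)
  exact absurd this (not_le.mpr hlt)

/-- **`E(K)[p]` is cyclic for every elliptic curve over a field `K` of characteristic `0` carrying an ultrametric norm
with the unramified value condition at the odd prime `p`** (no `ζ_p` in `K` + the Weil-pairing corollary, sequel file
`LocalPTorsionLine` §1). [cite: SilvermanAEC2009, Cor. III.8.1.1] [cite: SerreLocalFields1979, IV §4 Prop 17] -/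
theorem isAddCyclic_torsionBy_prime_of_unramified [CharZero K] (hp2 : p ≠ 2) (hpK : ‖(p : K)‖ < 1)
    (hK : ∀ x : K, ‖x‖ < 1 → ‖x‖ ≤ ‖(p : K)‖) (V : WeierstrassCurve K) [V.IsElliptic] :
    IsAddCyclic (AddSubgroup.torsionBy V.toAffine.Point (p : ℤ)) :=
  isAddCyclic_torsionBy_prime_of_forall_not_isPrimitiveRoot V p
    (not_isPrimitiveRoot_of_unramified p hp2 (by exact_mod_cast hp.out.ne_zero) hpK hK)

/-- **`#E(K)[p] ∣ p`** over such a `K` (`p` odd). [cite: SilvermanAEC2009, Cor. III.8.1.1] -/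
theorem natCard_torsionBy_prime_dvd_of_unramified [CharZero K] (hp2 : p ≠ 2) (hpK : ‖(p : K)‖ < 1)
    (hK : ∀ x : K, ‖x‖ < 1 → ‖x‖ ≤ ‖(p : K)‖) (V : WeierstrassCurve K) [V.IsElliptic] :
    Nat.card (AddSubgroup.torsionBy V.toAffine.Point (p : ℤ)) ∣ p :=
  natCard_torsionBy_prime_dvd_of_forall_not_isPrimitiveRoot V p
    (not_isPrimitiveRoot_of_unramified p hp2 (by exact_mod_cast hp.out.ne_zero) hpK hK)

/-- **Generator form** over such a `K` (`p` odd): some `P` with `p • P = O` of which every `K`-rational `p`-torsion point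
is an `ℕ`-multiple. [cite: SilvermanAEC2009, Cor. III.8.1.1] -/
theorem exists_generator_of_unramified [CharZero K] (hp2 : p ≠ 2) (hpK : ‖(p : K)‖ < 1)
    (hK : ∀ x : K, ‖x‖ < 1 → ‖x‖ ≤ ‖(p : K)‖) (V : WeierstrassCurve K) [V.IsElliptic] :
    ∃ P : V.toAffine.Point, p • P = 0 ∧ ∀ Q : V.toAffine.Point, p • Q = 0 → ∃ k : ℕ, Q = k • P :=
  exists_generator_of_forall_not_isPrimitiveRoot V p
    (not_isPrimitiveRoot_of_unramified p hp2 (by exact_mod_cast hp.out.ne_zero) hpK hK)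

end Unramified

/-! ## §2 The `ℚ_p`-algebra currency of the F″ programme (`NormedAlgebra ℚ_[p] K`, unramified value condition) -/

section PadicAlgebra

variable (p : ℕ) [hp : Fact p.Prime] {K : Type*} [NormedField K] [NormedAlgebra ℚ_[p] K] [IsUltrametricDist K]

omit [IsUltrametricDist K] in
/-- In a normed `ℚ_p`-algebra field: `‖(p : K)‖ = ‖p‖_p < 1` and `(p : K) ≠ 0`. [folklore] -/
theorem norm_natCast_prime_lt_one_padicAlgebra : ‖(p : K)‖ < 1 ∧ (p : K) ≠ 0 := by
  have e : (p : K) = algebraMap ℚ_[p] K (p : ℚ_[p]) := by rw [map_natCast]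
  refine ⟨?_, ?_⟩
  · rw [e, norm_algebraMap']; exact Padic.norm_p_lt_one
  · rw [e, map_ne_zero_iff _ (algebraMap ℚ_[p] K).injective]; exact_mod_cast hp.out.ne_zero

/-- **An UNRAMIFIED normed `ℚ_p`-algebra field (`‖x‖ < 1 → ‖x‖ ≤ ‖p‖`) contains no primitive `p`-th root of unity,
`p` odd** — e.g. the unramified completions `ℚ(ζ_m)_v`, `p ∤ m`, of the F″ receptacle.
[cite: SerreLocalFields1979, IV §4 Prop 17] [cite: Serre1973, Ch. II §3.1 Prop. 7] -/
theorem not_isPrimitiveRoot_of_unramified_padicAlgebra (hp2 : p ≠ 2)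
    (hK : ∀ x : K, ‖x‖ < 1 → ‖x‖ ≤ ‖(p : K)‖) (ζ : K) : ¬ IsPrimitiveRoot ζ p :=
  not_isPrimitiveRoot_of_unramified p hp2 (norm_natCast_prime_lt_one_padicAlgebra p).2
    (norm_natCast_prime_lt_one_padicAlgebra p).1 hK ζ

/-- **`E(K)[p]` is CYCLIC for every elliptic curve over an unramified normed `ℚ_p`-algebra field `K`, `p` odd** — the
`𝔽_p`-dimension bound «`dim E(K)[p] ≤ 1`» of the F″ programme's torsion descent (T57), from the PROVED Weil pairing
(Silverman III.8.1.1) and `ζ_p ∉ K`. [cite: SilvermanAEC2009, Cor. III.8.1.1] [cite: KostersPannekoek2017, Thm. 1 and Cor. 2] -/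
theorem isAddCyclic_torsionBy_prime_of_unramified_padicAlgebra (hp2 : p ≠ 2)
    (hK : ∀ x : K, ‖x‖ < 1 → ‖x‖ ≤ ‖(p : K)‖) (V : WeierstrassCurve K) [V.IsElliptic] :
    IsAddCyclic (AddSubgroup.torsionBy V.toAffine.Point (p : ℤ)) :=
  haveI : CharZero K := charZero_of_injective_algebraMap (algebraMap ℚ_[p] K).injective
  isAddCyclic_torsionBy_prime_of_forall_not_isPrimitiveRoot V p
    (not_isPrimitiveRoot_of_unramified_padicAlgebra p hp2 hK)

/-- **`#E(K)[p] ∣ p`** over such a `K` (`p` odd). [cite: SilvermanAEC2009, Cor. III.8.1.1] -/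
theorem natCard_torsionBy_prime_dvd_of_unramified_padicAlgebra (hp2 : p ≠ 2)
    (hK : ∀ x : K, ‖x‖ < 1 → ‖x‖ ≤ ‖(p : K)‖) (V : WeierstrassCurve K) [V.IsElliptic] :
    Nat.card (AddSubgroup.torsionBy V.toAffine.Point (p : ℤ)) ∣ p :=
  haveI : CharZero K := charZero_of_injective_algebraMap (algebraMap ℚ_[p] K).injective
  natCard_torsionBy_prime_dvd_of_forall_not_isPrimitiveRoot V p
    (not_isPrimitiveRoot_of_unramified_padicAlgebra p hp2 hK)

/-- **Generator form** over such a `K` (`p` odd): some `P` with `p • P = O` of which every `K`-rational `p`-torsion point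
is an `ℕ`-multiple. [cite: SilvermanAEC2009, Cor. III.8.1.1] -/
theorem exists_generator_of_unramified_padicAlgebra (hp2 : p ≠ 2)
    (hK : ∀ x : K, ‖x‖ < 1 → ‖x‖ ≤ ‖(p : K)‖) (V : WeierstrassCurve K) [V.IsElliptic] :
    ∃ P : V.toAffine.Point, p • P = 0 ∧ ∀ Q : V.toAffine.Point, p • Q = 0 → ∃ k : ℕ, Q = k • P :=
  haveI : CharZero K := charZero_of_injective_algebraMap (algebraMap ℚ_[p] K).injective
  exists_generator_of_forall_not_isPrimitiveRoot V p
    (not_isPrimitiveRoot_of_unramified_padicAlgebra p hp2 hK)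

/-- **The descent shape**: over an unramified normed `ℚ_p`-algebra field (`p` odd) a NON-ZERO `K`-rational point `P`
of order `p` spans the whole `K`-rational `p`-torsion — every `Q` with `p • Q = O` is `k • P`, `k : ℕ`; two
`𝔽_p`-independent `K`-rational `p`-torsion points never exist. (For `K = ℚ_p` and curves over `ℚ` this is the sibling
seat's `LocalPTorsion.exists_nsmul_eq_of_pTorsion_padic`.) [cite: SilvermanAEC2009, Cor. III.8.1.1]
[cite: KostersPannekoek2017, Thm. 1 and Cor. 2] -/
theorem exists_nsmul_eq_of_unramified_padicAlgebra (hp2 : p ≠ 2)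
    (hK : ∀ x : K, ‖x‖ < 1 → ‖x‖ ≤ ‖(p : K)‖) (V : WeierstrassCurve K) [V.IsElliptic]
    {P Q : V.toAffine.Point} (hP : p • P = 0) (hP0 : P ≠ 0) (hQ : p • Q = 0) : ∃ k : ℕ, Q = k • P := by
  haveI : CharZero K := charZero_of_injective_algebraMap (algebraMap ℚ_[p] K).injective
  haveI := (finite_torsionBy_prime_and_natCard_le V p).1
  -- the `p`-torsion has order `1` or `p`; with `P ≠ 0` it has prime order `p` and `P` generates
  have hdvd := natCard_torsionBy_prime_dvd_of_unramified_padicAlgebra p hp2 hK V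
  set T := AddSubgroup.torsionBy V.toAffine.Point (p : ℤ)
  have hPT : P ∈ T := AddSubgroup.torsionBy.nsmul_iff.mpr hP
  have hQT : Q ∈ T := AddSubgroup.torsionBy.nsmul_iff.mpr hQ
  have hcard : Nat.card T = p := by
    rcases (Nat.dvd_prime hp.out).mp hdvd with h1 | h
    · exfalso
      haveI : Subsingleton T := (Nat.card_eq_one_iff_unique.mp h1).1
      exact hP0 (congrArg Subtype.val (Subsingleton.elim (⟨P, hPT⟩ : T) 0))
    · exact h
  have hne : (⟨P, hPT⟩ : T) ≠ 0 := fun h ↦ hP0 (congrArg Subtype.val h)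
  have hmem : (⟨Q, hQT⟩ : T) ∈ AddSubmonoid.multiples (⟨P, hPT⟩ : T) :=
    mem_multiples_of_prime_card hcard hne
  obtain ⟨k, hk⟩ := (AddSubmonoid.mem_multiples_iff _ _).mp hmem
  exact ⟨k, by simpa using (congrArg Subtype.val hk).symm⟩

end PadicAlgebra

end Summit.BirchSwinnertonDyer.BirchSwinnertonDyer.Theorems.TeichmullerTwistDescent.LocalPTorsionLine

end
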